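import Summits.HodgeConjecture.HodgeConjecture.Theorems.H413SpectrumJunction
import Literature.NumberTheory.Automorphic.DiscreteSummandProjection
import HarnessLib

/-!
# FLOOR-0 programme P2, (D) desk (`F0_P2SpectralProjectionD`): the HEAD-SIDE DICTIONARY — `Lp` ∕ `toQuotFun` transport
# lemmas the head of the (D) line consumes (GENERIC over an adelic group datum `𝒢`)

Cell hodgecm-mathlib, FLOOR 0; crux item H413 = stmt-HodgeConjecture-24833; prover F0P2-p03 (g2) on F0P2-plan (g2)'s ruling R3
(2026-08-30T23:35Z: «take the HEAD-SIDE DICTIONARY … SEARCH FIRST … REUSE by name»).  PROOF FILE: theorems only — no definition,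
no instance, no notation, no named fact, no `sorry`; imports ★ `Theorems.H413SpectrumJunction` (F0P3-p04: the `toQuotFun` calculus,
★ `toLp_toQuotFun_mul_right`) + ★ `Literature/…/DiscreteSummandProjection` (F0P2-p02: ★ `starProjection_rightRegular`).

WHAT IS ★ ALREADY (reused BY NAME, not restated): `SpectrumJunction.toQuotFun_mul_right_apply` (`toQuotFun (Φ(· h)) y =
toQuotFun Φ (h⁻¹ • y)`), `SpectrumJunction.toLp_toQuotFun_mul_right` (`[Φ(· h)] = R(h)[Φ]` given BOTH `MemLp` witnesses),
`SpectrumJunction.memLp_toQuotFun` (continuous on a compact quotient ⇒ `L^p`), `SpectrumJunction.toLp_toQuotFun_ne_zero`,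
`SpectrumJunction.apply_eq_toQuotFun`, `DiscreteAutomorphicRep.starProjection_rightRegular` (`p_P ∘ R(h) = R(h) ∘ p_P`),
Mathlib `MemLp.toLp_eq_toLp_iff` (`[f] = [g] ↔ f =ᵐ g`), `Continuous.ae_eq_iff_eq`.

WHAT THIS FILE ADDS (the three shapes the head needs verbatim):
* `memLp_toQuotFun_mul_right` — the `MemLp` witness of a right translate comes for free (measure-preserving `q ↦ h⁻¹ • q`), so
  the head never carries a second `MemLp` binder; `rightRegular_toLp_toQuotFun` — F0P2-plan's (T1)
  `R(a) (toLp (toQuotFun (Φ · j))) = toLp (toQuotFun (x ↦ Φ (x a) j))` for ARBITRARY `a : 𝒢.Adelic`, with the witness supplied;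
  `starProjection_rightRegular_toLp_toQuotFun` — the same pushed through `p_P`.
* `toLp_toQuotFun_eq_toLp_toQuotFun_iff` — (T2) packaging: for CONTINUOUS left-invariant `Φ, Ψ` and `μ` positive on opens,
  `toLp (toQuotFun Φ) = toLp (toQuotFun Ψ) ↔ Φ = Ψ` (a.e. ⇒ everywhere); `…_iff_ae` without continuity.
* the `Fin 2`-coordinate corollaries for `ℂ²`-valued forms (`Φ : 𝒢.Adelic → Fin 2 → ℂ`), the currency of ★ `ContainsForm` ∕ (D).
HC_CM is proved only modulo the 7 printed citations until rung 0 closes.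

References: A. Borel, H. Jacquet, *Automorphic forms and automorphic representations*, PSPM 33.1 (1979), §4.2, §4.6
[BorelJacquet1979]; D. Bump, *Automorphic forms and representations* (1997), Thm. 3.6.1 [Bump1997].
-/

set_option autoImplicit false

-- the mandated namespace has the single-problem summit's repeated segment (`HodgeConjecture.HodgeConjecture`)
set_option linter.dupNamespace false

noncomputable section

namespace Summit.HodgeConjecture.HodgeConjecture.Cruxes.H413.P2SpectralProjectionDictionary

open MeasureTheory NumberField Topology
open scoped ENNReal
open Literature.NumberTheory.Automorphic Literature.NumberTheory.Automorphic.UnitaryGroup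
open Literature.NumberTheory.Automorphic.UnitaryGroup.CotangentForms (toQuotFun toQuotFun_mk)
open Summit.HodgeConjecture.HodgeConjecture.Cruxes.H413.SpectrumJunction

/-! ## §1 Right translates: `MemLp` witness, the regular representation, the spectral projection -/

section Scalar

variable {K : Type} [Field K] [NumberField K] {𝒢 : AdelicGroupData.{0} K}
  {μ : Measure 𝒢.automorphicQuotient} [SMulInvariantMeasure 𝒢.Adelic 𝒢.automorphicQuotient μ]

/-- **The `MemLp` witness of a right translate is free**: for left-invariant `Φ` with `toQuotFun Φ ∈ L^p(μ)` and any
`h ∈ G(𝔸_K)`, `toQuotFun (x ↦ Φ (x h)) = (toQuotFun Φ) ∘ (h⁻¹ • ·) ∈ L^p(μ)` (`μ` is `G(𝔸_K)`-invariant). [cite: BorelJacquet1979, §4.2 and §4.6] -/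
theorem memLp_toQuotFun_mul_right {Φ : 𝒢.Adelic → ℂ} (hΦ : ∀ γ ∈ 𝒢.quotientSubgroup, ∀ g, Φ (γ * g) = Φ g)
    (h : 𝒢.Adelic) {p : ℝ≥0∞} (hmem : MemLp (toQuotFun 𝒢 Φ) p μ) :
    MemLp (toQuotFun 𝒢 fun x => Φ (x * h)) p μ := by
  have heq : (toQuotFun 𝒢 fun x => Φ (x * h)) = toQuotFun 𝒢 Φ ∘ fun y => h⁻¹ • y :=
    funext fun y => toQuotFun_mul_right_apply hΦ h y
  rw [heq]
  exact hmem.comp_measurePreserving (measurePreserving_smul h⁻¹ μ)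

/-- **(T1) The regular representation on the class of a form, with the witness supplied**: for left-invariant `Φ` with
`toQuotFun Φ ∈ L²(μ)` and ANY `a ∈ G(𝔸_K)` (finite-adelic, archimedean `ιinf u`, or compact `k ∈ K_c` alike),
`R(a) [toQuotFun Φ] = [toQuotFun (x ↦ Φ (x a))]` (★ `toLp_toQuotFun_mul_right`, ★ `rightRegular_apply_coeFn`).
[cite: BorelJacquet1979, §4.6] -/
theorem rightRegular_toLp_toQuotFun {Φ : 𝒢.Adelic → ℂ} (hΦ : ∀ γ ∈ 𝒢.quotientSubgroup, ∀ g, Φ (γ * g) = Φ g)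
    (a : 𝒢.Adelic) (hmem : MemLp (toQuotFun 𝒢 Φ) 2 μ) :
    𝒢.rightRegular μ a (hmem.toLp (toQuotFun 𝒢 Φ)) =
      (memLp_toQuotFun_mul_right hΦ a hmem).toLp (toQuotFun 𝒢 fun x => Φ (x * a)) :=
  (toLp_toQuotFun_mul_right hΦ a hmem (memLp_toQuotFun_mul_right hΦ a hmem)).symm

/-- the same against an ARBITRARY `MemLp` witness of the translate (proof-irrelevant repackaging of ★
`toLp_toQuotFun_mul_right`). [cite: BorelJacquet1979, §4.6] -/
theorem rightRegular_toLp_toQuotFun' {Φ : 𝒢.Adelic → ℂ} (hΦ : ∀ γ ∈ 𝒢.quotientSubgroup, ∀ g, Φ (γ * g) = Φ g)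
    (a : 𝒢.Adelic) (hmem : MemLp (toQuotFun 𝒢 Φ) 2 μ) (hmem' : MemLp (toQuotFun 𝒢 fun x => Φ (x * a)) 2 μ) :
    𝒢.rightRegular μ a (hmem.toLp (toQuotFun 𝒢 Φ)) = hmem'.toLp (toQuotFun 𝒢 fun x => Φ (x * a)) :=
  (toLp_toQuotFun_mul_right hΦ a hmem hmem').symm

/-- **(T1) through the spectral projection**: `p_P (R(a) [toQuotFun Φ]) = R(a) (p_P [toQuotFun Φ])` and hence
`p_P [toQuotFun (x ↦ Φ (x a))] = R(a) (p_P [toQuotFun Φ])` (★ `starProjection_rightRegular`). [cite: BorelJacquet1979, §4.6]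
[cite: Bump1997, Thm. 3.6.1 (proof, p. 342)] -/
theorem starProjection_toLp_toQuotFun_mul_right (P : DiscreteAutomorphicRep 𝒢 μ) {Φ : 𝒢.Adelic → ℂ}
    (hΦ : ∀ γ ∈ 𝒢.quotientSubgroup, ∀ g, Φ (γ * g) = Φ g) (a : 𝒢.Adelic) (hmem : MemLp (toQuotFun 𝒢 Φ) 2 μ)
    (hmem' : MemLp (toQuotFun 𝒢 fun x => Φ (x * a)) 2 μ) :
    P.space.toSubmodule.starProjection (hmem'.toLp (toQuotFun 𝒢 fun x => Φ (x * a))) =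
      𝒢.rightRegular μ a (P.space.toSubmodule.starProjection (hmem.toLp (toQuotFun 𝒢 Φ))) := by
  rw [toLp_toQuotFun_mul_right hΦ a hmem hmem', P.starProjection_rightRegular]

/-! ## §2 (T2) Classes versus functions -/

omit [SMulInvariantMeasure 𝒢.Adelic 𝒢.automorphicQuotient μ] in
/-- **(T2, a.e. form)** `[toQuotFun Φ] = [toQuotFun Ψ] ↔ toQuotFun Φ =ᵐ toQuotFun Ψ` (Mathlib `MemLp.toLp_eq_toLp_iff`).
[cite: BorelJacquet1979, §4.6] -/
theorem toLp_toQuotFun_eq_toLp_toQuotFun_iff_ae {Φ Ψ : 𝒢.Adelic → ℂ} {p : ℝ≥0∞}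
    (hΦm : MemLp (toQuotFun 𝒢 Φ) p μ) (hΨm : MemLp (toQuotFun 𝒢 Ψ) p μ) :
    hΦm.toLp (toQuotFun 𝒢 Φ) = hΨm.toLp (toQuotFun 𝒢 Ψ) ↔ toQuotFun 𝒢 Φ =ᵐ[μ] toQuotFun 𝒢 Ψ :=
  MemLp.toLp_eq_toLp_iff hΦm hΨm

omit [SMulInvariantMeasure 𝒢.Adelic 𝒢.automorphicQuotient μ] in
/-- **(T2) Equal classes of CONTINUOUS left-invariant functions are equal functions on `G(𝔸_K)`** (`μ` positive on open
sets: two continuous functions agreeing a.e. agree; then lift along ★ `apply_eq_toQuotFun`). [cite: BorelJacquet1979, §4.2 and §4.6] -/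
theorem toLp_toQuotFun_eq_toLp_toQuotFun_iff [μ.IsOpenPosMeasure] {Φ Ψ : 𝒢.Adelic → ℂ}
    (hΦ : ∀ γ ∈ 𝒢.quotientSubgroup, ∀ g, Φ (γ * g) = Φ g) (hΨ : ∀ γ ∈ 𝒢.quotientSubgroup, ∀ g, Ψ (γ * g) = Ψ g)
    (hΦc : Continuous Φ) (hΨc : Continuous Ψ) {p : ℝ≥0∞}
    (hΦm : MemLp (toQuotFun 𝒢 Φ) p μ) (hΨm : MemLp (toQuotFun 𝒢 Ψ) p μ) :
    hΦm.toLp (toQuotFun 𝒢 Φ) = hΨm.toLp (toQuotFun 𝒢 Ψ) ↔ Φ = Ψ := by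
  rw [toLp_toQuotFun_eq_toLp_toQuotFun_iff_ae,
    Continuous.ae_eq_iff_eq μ (continuous_toQuotFun hΦ hΦc) (continuous_toQuotFun hΨ hΨc)]
  constructor
  · intro h
    funext g
    rw [apply_eq_toQuotFun hΦ g, apply_eq_toQuotFun hΨ g, h]
  · rintro rfl
    rfl

omit [SMulInvariantMeasure 𝒢.Adelic 𝒢.automorphicQuotient μ] in
/-- **a.e.-to-everywhere for ONE continuous representative**: if the class of a continuous left-invariant `Ψ` is a given
`v ∈ L^p` and the class of another continuous left-invariant `Ψ'` is the same `v`, then `Ψ = Ψ'` — the uniqueness of the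
continuous representative the (D) head uses to turn class identities into pointwise ones. [cite: BorelJacquet1979, §4.2 and §4.6] -/
theorem eq_of_toLp_toQuotFun_eq [μ.IsOpenPosMeasure] {Φ Ψ : 𝒢.Adelic → ℂ}
    (hΦ : ∀ γ ∈ 𝒢.quotientSubgroup, ∀ g, Φ (γ * g) = Φ g) (hΨ : ∀ γ ∈ 𝒢.quotientSubgroup, ∀ g, Ψ (γ * g) = Ψ g)
    (hΦc : Continuous Φ) (hΨc : Continuous Ψ) {p : ℝ≥0∞}
    (hΦm : MemLp (toQuotFun 𝒢 Φ) p μ) (hΨm : MemLp (toQuotFun 𝒢 Ψ) p μ)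
    (h : hΦm.toLp (toQuotFun 𝒢 Φ) = hΨm.toLp (toQuotFun 𝒢 Ψ)) : Φ = Ψ :=
  (toLp_toQuotFun_eq_toLp_toQuotFun_iff hΦ hΨ hΦc hΨc hΦm hΨm).mp h

/-- **Pointwise right-invariance from class-level invariance** (the shape of the head's transfer of `K_c` ∕ `K_f′`
invariance to the continuous representative): for continuous left-invariant `Ψ` with `R(k)[Ψ] = [Ψ]`, `Ψ (x k) = Ψ x` for all
`x`. [cite: BorelJacquet1979, §4.2 and §4.6] -/
theorem apply_mul_eq_of_rightRegular_toLp_eq [μ.IsOpenPosMeasure] {Ψ : 𝒢.Adelic → ℂ}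
    (hΨ : ∀ γ ∈ 𝒢.quotientSubgroup, ∀ g, Ψ (γ * g) = Ψ g) (hΨc : Continuous Ψ)
    (hΨm : MemLp (toQuotFun 𝒢 Ψ) 2 μ) {k : 𝒢.Adelic}
    (hk : 𝒢.rightRegular μ k (hΨm.toLp (toQuotFun 𝒢 Ψ)) = hΨm.toLp (toQuotFun 𝒢 Ψ)) (x : 𝒢.Adelic) :
    Ψ (x * k) = Ψ x := by
  rw [rightRegular_toLp_toQuotFun hΨ k hΨm] at hk
  have hc' : Continuous fun x => Ψ (x * k) := hΨc.comp (continuous_mul_const k)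
  exact congrFun (eq_of_toLp_toQuotFun_eq (leftInvariant_mul_right hΨ k) hΨ hc' hΨc _ hΨm hk) x

end Scalar

/-! ## §3 The `ℂ²`-valued (coordinatewise) corollaries — the currency of `ContainsForm` and of letter (D) -/

section Pair

variable {K : Type} [Field K] [NumberField K] {𝒢 : AdelicGroupData.{0} K}
  {μ : Measure 𝒢.automorphicQuotient} [SMulInvariantMeasure 𝒢.Adelic 𝒢.automorphicQuotient μ]

/-- left-invariance of a `ℂ²`-valued function is left-invariance of each coordinate. [cite: BorelJacquet1979, §4.2] -/
theorem leftInvariant_apply {Φ : 𝒢.Adelic → (Fin 2 → ℂ)} (hΦ : ∀ γ ∈ 𝒢.quotientSubgroup, ∀ g, Φ (γ * g) = Φ g)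
    (j : Fin 2) : ∀ γ ∈ 𝒢.quotientSubgroup, ∀ g, (fun x => Φ x j) (γ * g) = (fun x => Φ x j) g :=
  fun γ hγ g => by simp only [hΦ γ hγ g]

/-- **(T1), coordinatewise**: `R(a) [toQuotFun (Φ · j)] = [toQuotFun (x ↦ Φ (x a) j)]` for a left-invariant `ℂ²`-valued `Φ`
with `L²` coordinates, ANY `a ∈ G(𝔸_K)`; the witness of the translate is supplied. [cite: BorelJacquet1979, §4.6] -/
theorem rightRegular_toLp_toQuotFun_apply {Φ : 𝒢.Adelic → (Fin 2 → ℂ)}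
    (hΦ : ∀ γ ∈ 𝒢.quotientSubgroup, ∀ g, Φ (γ * g) = Φ g) (a : 𝒢.Adelic)
    (hmem : ∀ j : Fin 2, MemLp (toQuotFun 𝒢 fun x => Φ x j) 2 μ) (j : Fin 2) :
    𝒢.rightRegular μ a ((hmem j).toLp (toQuotFun 𝒢 fun x => Φ x j)) =
      (memLp_toQuotFun_mul_right (leftInvariant_apply hΦ j) a (hmem j)).toLp
        (toQuotFun 𝒢 fun x => Φ (x * a) j) :=
  rightRegular_toLp_toQuotFun (leftInvariant_apply hΦ j) a (hmem j)

/-- **(T1) through `p_P`, coordinatewise**: `p_P [toQuotFun (x ↦ Φ (x a) j)] = R(a) (p_P [toQuotFun (Φ · j)])`.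
[cite: BorelJacquet1979, §4.6] [cite: Bump1997, Thm. 3.6.1 (proof, p. 342)] -/
theorem starProjection_toLp_toQuotFun_mul_right_apply (P : DiscreteAutomorphicRep 𝒢 μ)
    {Φ : 𝒢.Adelic → (Fin 2 → ℂ)} (hΦ : ∀ γ ∈ 𝒢.quotientSubgroup, ∀ g, Φ (γ * g) = Φ g) (a : 𝒢.Adelic)
    (hmem : ∀ j : Fin 2, MemLp (toQuotFun 𝒢 fun x => Φ x j) 2 μ)
    (hmem' : ∀ j : Fin 2, MemLp (toQuotFun 𝒢 fun x => Φ (x * a) j) 2 μ) (j : Fin 2) :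
    P.space.toSubmodule.starProjection ((hmem' j).toLp (toQuotFun 𝒢 fun x => Φ (x * a) j)) =
      𝒢.rightRegular μ a (P.space.toSubmodule.starProjection ((hmem j).toLp (toQuotFun 𝒢 fun x => Φ x j))) :=
  starProjection_toLp_toQuotFun_mul_right P (leftInvariant_apply hΦ j) a (hmem j) (hmem' j)

omit [SMulInvariantMeasure 𝒢.Adelic 𝒢.automorphicQuotient μ] in
/-- **(T2), coordinatewise**: two continuous left-invariant `ℂ²`-valued functions with equal coordinate classes are equal.
[cite: BorelJacquet1979, §4.2 and §4.6] -/
theorem eq_of_forall_toLp_toQuotFun_apply_eq [μ.IsOpenPosMeasure] {Φ Ψ : 𝒢.Adelic → (Fin 2 → ℂ)}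
    (hΦ : ∀ γ ∈ 𝒢.quotientSubgroup, ∀ g, Φ (γ * g) = Φ g) (hΨ : ∀ γ ∈ 𝒢.quotientSubgroup, ∀ g, Ψ (γ * g) = Ψ g)
    (hΦc : ∀ j : Fin 2, Continuous fun x => Φ x j) (hΨc : ∀ j : Fin 2, Continuous fun x => Ψ x j) {p : ℝ≥0∞}
    (hΦm : ∀ j : Fin 2, MemLp (toQuotFun 𝒢 fun x => Φ x j) p μ) (hΨm : ∀ j : Fin 2, MemLp (toQuotFun 𝒢 fun x => Ψ x j) p μ)
    (h : ∀ j : Fin 2, (hΦm j).toLp (toQuotFun 𝒢 fun x => Φ x j) = (hΨm j).toLp (toQuotFun 𝒢 fun x => Ψ x j)) :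
    Φ = Ψ := by
  funext x j
  exact congrFun (eq_of_toLp_toQuotFun_eq (leftInvariant_apply hΦ j) (leftInvariant_apply hΨ j) (hΦc j) (hΨc j)
    (hΦm j) (hΨm j) (h j)) x

end Pair

end Summit.HodgeConjecture.HodgeConjecture.Cruxes.H413.P2SpectralProjectionDictionary

end
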